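import Mathlib.Topology.Algebra.Category.ProfiniteGrp.Completion
import Mathlib.Topology.Algebra.Group.Basic
import Mathlib.GroupTheory.OrderOfElement
import Mathlib.Data.ZMod.Basic
import Literature.AnabelianGeometry.SemiGraphs.TemperedAnabelian
import HarnessLib

/-!
# Finite-quotient coordinates on the profinite completion of a discrete group

Companion (theorems only) of `Literature/AnabelianGeometry/SemiGraphs/TemperedAnabelian.lean`,
serving the discharge of the named fact `FreeGroupNormallyTerminalInCompletion`
([SemiAnbd] Lemma 6.1 (i), abc-iut node `SemiAnbd:Lem6.1(i)`, DISCHARGE-L3 item G14).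

Mathlib's profinite completion `F̂ := ProfiniteGrp.ProfiniteCompletion.completion (GrpCat.of F)` of a
group `F` is, by construction (`ProfiniteGrp.limitConePtAux`), the subgroup of the product
`Π_K F ⧸ K` over the finite-index normal subgroups `K` of `F` consisting of the compatible families,
with the subspace topology of the product of the discrete groups `F ⧸ K`; the canonical map
`toProfiniteCompletion F : F →* F̂` sends `f` to the constant family `(f mod K)_K`.  We record:

* the *coordinates* `x.val K ∈ F ⧸ K` of `x : F̂`, their multiplicativity, compatibility along
  `K ≤ L`, representatives, and the extensionality principle (`completion_ext`);
* the **cylinder description of closures**: `x ∈ closure (ι '' S)` iff every coordinate `x.val K`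
  is the class of an element of `S` (`exists_mem_of_mem_closure`, `mem_closure_of_forall_exists`);
* injectivity of `ι` for residually finite `F`;
* **separation of two independent cyclic subgroups** (`eq_one_of_mem_closure_zpowers`,
  `mem_image_zpowers_of_mul_mem_range`): if `F` is residually finite and `y₁, y₂ ∈ F` admit a
  homomorphism `ψ : F → ℤ²` with `ψ y₁ = (1,0)`, `ψ y₂ = (0,1)`, then in `F̂` the closures
  `A = cl ι⟨y₁⟩`, `B = cl ι⟨y₂⟩` satisfy `A ∩ B = 1` and `A·B ∩ ι(F) = ι(⟨y₁⟩⟨y₂⟩)` with unique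
  factors — proved through the finite quotients `F ⧸ (K ⊓ ker (ψ mod [F:K]))`.

All statements are folklore profinite-group bookkeeping; no new definitions are introduced.
-/

namespace Literature.AnabelianGeometry.SemiGraphs

open CategoryTheory ProfiniteGrp ProfiniteGrp.ProfiniteCompletion
open _root_.Topology

universe u

variable {F : Type u} [Group F]

/-! ### Coordinates of elements of the profinite completion -/

/-- The `K`-coordinate of `ι f` is the class of `f` in `F ⧸ K`. [cite: MochizukiSemiAnbd2006, §6 p.69 (profinite completion)] -/
theorem toProfiniteCompletion_val (f : F) (K : FiniteIndexNormalSubgroup F) :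
    (toProfiniteCompletion F f).val K = (f : F ⧸ K.toSubgroup) := rfl

/-- Coordinates are multiplicative. [cite: MochizukiSemiAnbd2006, §6 p.69 (profinite completion)] -/
theorem completion_mul_val (x y : completion (GrpCat.of F)) (K : FiniteIndexNormalSubgroup F) :
    (x * y).val K = x.val K * y.val K := rfl

/-- Coordinates commute with inversion. [cite: MochizukiSemiAnbd2006, §6 p.69 (profinite completion)] -/
theorem completion_inv_val (x : completion (GrpCat.of F)) (K : FiniteIndexNormalSubgroup F) :
    x⁻¹.val K = (x.val K)⁻¹ := rfl

/-- The coordinates of `1` are `1`. [cite: MochizukiSemiAnbd2006, §6 p.69 (profinite completion)] -/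
theorem completion_one_val (K : FiniteIndexNormalSubgroup F) :
    (1 : completion (GrpCat.of F)).val K = 1 := rfl

/-- Compatibility of the coordinates along `K ≤ L`. [cite: MochizukiSemiAnbd2006, §6 p.69 (profinite completion)] -/
theorem completion_val_map (x : completion (GrpCat.of F)) {K L : FiniteIndexNormalSubgroup F}
    (h : K ≤ L) :
    QuotientGroup.map K.toSubgroup L.toSubgroup (MonoidHom.id F) h (x.val K) = x.val L :=
  x.property (homOfLE h)

/-- An element of the profinite completion is determined by its coordinates. [cite: MochizukiSemiAnbd2006, §6 p.69 (profinite completion)] -/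
theorem completion_ext {x y : completion (GrpCat.of F)}
    (h : ∀ K : FiniteIndexNormalSubgroup F, x.val K = y.val K) : x = y :=
  ProfiniteGrp.limit_ext _ x y h

/-- Every coordinate has a representative in `F`. [cite: MochizukiSemiAnbd2006, §6 p.69 (profinite completion)] -/
theorem completion_exists_rep (x : completion (GrpCat.of F)) (K : FiniteIndexNormalSubgroup F) :
    ∃ γ : F, (γ : F ⧸ K.toSubgroup) = x.val K :=
  QuotientGroup.mk_surjective (x.val K)

/-- A representative of the `K`-coordinate is a representative of the `L`-coordinate for every
`L ≥ K`. [cite: MochizukiSemiAnbd2006, §6 p.69 (profinite completion)] -/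
theorem completion_rep_of_le (x : completion (GrpCat.of F)) {K L : FiniteIndexNormalSubgroup F}
    (h : K ≤ L) {γ : F} (hγ : (γ : F ⧸ K.toSubgroup) = x.val K) :
    (γ : F ⧸ L.toSubgroup) = x.val L := by
  rw [← completion_val_map x h, ← hγ]
  rfl

/-- The coordinate maps are continuous. [cite: MochizukiSemiAnbd2006, §6 p.69 (profinite completion)] -/
theorem completion_continuous_val (K : FiniteIndexNormalSubgroup F) :
    Continuous (fun x : completion (GrpCat.of F) => x.val K) :=
  ((limitCone (diagram (GrpCat.of F))).π.app K).hom.continuous_toFun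

/-- The finite quotients carry the discrete topology inside the completion diagram. [cite: MochizukiSemiAnbd2006, §6 p.69 (profinite completion)] -/
theorem completion_discreteTopology_obj (K : FiniteIndexNormalSubgroup F) :
    DiscreteTopology ((diagram (GrpCat.of F)).obj K) := ⟨rfl⟩

/-! ### Closures of subsets of `F` inside `F̂`: the cylinder description -/

/-- If `x` lies in the closure of `ι '' S`, every coordinate of `x` is the class of an element of
`S`. [cite: MochizukiSemiAnbd2006, §6 p.69 (profinite completion)] -/
theorem exists_mem_of_mem_closure {S : Set F} {x : completion (GrpCat.of F)}
    (hx : x ∈ closure (toProfiniteCompletion F '' S)) (K : FiniteIndexNormalSubgroup F) :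
    ∃ s ∈ S, (s : F ⧸ K.toSubgroup) = x.val K := by
  haveI : DiscreteTopology ((diagram (GrpCat.of F)).obj K) := completion_discreteTopology_obj K
  have hopen : IsOpen ((fun y : completion (GrpCat.of F) => y.val K) ⁻¹' {x.val K}) :=
    (isOpen_discrete _).preimage (completion_continuous_val K)
  obtain ⟨y, hyU, ⟨s, hs, rfl⟩⟩ := mem_closure_iff.1 hx _ hopen rfl
  exact ⟨s, hs, hyU⟩

/-- Conversely, if every coordinate of `x` is the class of an element of `S`, then `x` lies in the
closure of `ι '' S` (the cylinder sets form a basis of the topology of `F̂`). [cite: MochizukiSemiAnbd2006, §6 p.69 (profinite completion)] -/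
theorem mem_closure_of_forall_exists {S : Set F} {x : completion (GrpCat.of F)}
    (h : ∀ K : FiniteIndexNormalSubgroup F, ∃ s ∈ S, (s : F ⧸ K.toSubgroup) = x.val K) :
    x ∈ closure (toProfiniteCompletion F '' S) := by
  rw [mem_closure_iff]
  rintro U ⟨V, hVO, hVU⟩ hxU
  have hxV : x.val ∈ V := by
    rw [← hVU] at hxU
    exact hxU
  rcases (isOpen_pi_iff.mp hVO) _ hxV with ⟨J, t, hJ1, hJ2⟩
  let M : Subgroup F := ⨅ j : J, (j.val : FiniteIndexNormalSubgroup F).toSubgroup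
  have hM : M.Normal := Subgroup.normal_iInf_normal fun j => inferInstance
  have hMF : M.FiniteIndex := by
    apply Subgroup.finiteIndex_iInf
    intro j
    infer_instance
  let m : FiniteIndexNormalSubgroup F := { toSubgroup := M }
  obtain ⟨s, hsS, hs⟩ := h m
  refine ⟨toProfiniteCompletion F s, ?_, s, hsS, rfl⟩
  rw [← hVU]
  change (toProfiniteCompletion F s).val ∈ V
  refine hJ2 fun a haJ => ?_
  have hma : m ≤ a :=
    iInf_le (fun j : J => (j.val : FiniteIndexNormalSubgroup F).toSubgroup) ⟨a, haJ⟩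
  have hrep := completion_rep_of_le x hma hs
  change (toProfiniteCompletion F s).val a ∈ t a
  rw [toProfiniteCompletion_val, hrep]
  exact (hJ1 a haJ).2

/-- Membership in the topological closure of the image of a subgroup, coordinatewise. [cite: MochizukiSemiAnbd2006, §6 p.69 (profinite completion)] -/
theorem mem_topologicalClosure_map_iff (H : Subgroup F) (x : completion (GrpCat.of F)) :
    x ∈ (H.map (toProfiniteCompletion F)).topologicalClosure ↔
      ∀ K : FiniteIndexNormalSubgroup F, ∃ s ∈ H, (s : F ⧸ K.toSubgroup) = x.val K := by
  rw [← SetLike.mem_coe, Subgroup.topologicalClosure_coe, Subgroup.coe_map]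
  exact ⟨fun hx K => exists_mem_of_mem_closure hx K, fun h => mem_closure_of_forall_exists h⟩

/-- For a residually finite group the canonical map to the profinite completion is injective.
[cite: MochizukiSemiAnbd2006, §6 p.69 (profinite completion)] -/
theorem toProfiniteCompletion_injective [Group.ResiduallyFinite F] :
    Function.Injective (toProfiniteCompletion F) := fun _ _ h =>
  (etaFn_injective_iff_residuallyFinite (GrpCat.of F)).2
    (inferInstance : Group.ResiduallyFinite F) h

/-! ### Separation of two independent cyclic subgroups in the completion -/

section Separation

variable (ψ : F →* Multiplicative (ℤ × ℤ)) (y₁ y₂ : F)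

/-- Refinement step: below any finite-index normal `K` there is a finite-index normal `K'` (namely
`K ⊓ ker (ψ mod [F:K])`) such that `y₁ ^ i * y₂ ^ j * w ∈ K'` with `ψ w = 1` forces
`y₁ ^ i, y₂ ^ j, w ∈ K`. [cite: MochizukiSemiAnbd2006, Lem. 6.1(i) p.69] -/
theorem exists_finiteIndexNormalSubgroup_le_forall_zpow_mem
    (h₁ : ψ y₁ = Multiplicative.ofAdd (1, 0)) (h₂ : ψ y₂ = Multiplicative.ofAdd (0, 1))
    (K : FiniteIndexNormalSubgroup F) :
    ∃ K' : FiniteIndexNormalSubgroup F, K' ≤ K ∧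
      ∀ (i j : ℤ) (w : F), ψ w = 1 → y₁ ^ i * y₂ ^ j * w ∈ K' →
        y₁ ^ i ∈ K ∧ y₂ ^ j ∈ K ∧ w ∈ K := by
  set N : ℕ := K.toSubgroup.index with hN
  haveI : NeZero N := ⟨Subgroup.FiniteIndex.index_ne_zero⟩
  -- reduction of `ψ` modulo `N`
  let red : Multiplicative (ℤ × ℤ) →* Multiplicative (ZMod N × ZMod N) :=
    AddMonoidHom.toMultiplicative
      ((Int.castAddHom (ZMod N)).prodMap (Int.castAddHom (ZMod N)))
  let ψN : F →* Multiplicative (ZMod N × ZMod N) := red.comp ψ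
  haveI : ψN.ker.FiniteIndex := inferInstance
  let K' : FiniteIndexNormalSubgroup F := K ⊓ FiniteIndexNormalSubgroup.ofSubgroup ψN.ker
  have hK'K : K' ≤ K := inf_le_left
  have hK'ker : ∀ u : F, u ∈ K' → ψN u = 1 := fun u hu =>
    (MonoidHom.mem_ker).1 ((inf_le_right : K' ≤ _) hu)
  have hψN₁ : ψN y₁ = Multiplicative.ofAdd ((1 : ZMod N), 0) := by
    simp [ψN, red, h₁]
  have hψN₂ : ψN y₂ = Multiplicative.ofAdd (0, (1 : ZMod N)) := by
    simp [ψN, red, h₂]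
  have hpowN : ∀ (y : F) (i : ℤ), (N : ℤ) ∣ i → y ^ i ∈ K := by
    rintro y i ⟨c, rfl⟩
    rw [zpow_mul, zpow_natCast]
    exact Subgroup.zpow_mem _ (hN ▸ K.toSubgroup.pow_index_mem y) c
  refine ⟨K', hK'K, fun i j w hw hmem => ?_⟩
  have hker := hK'ker _ hmem
  rw [map_mul, map_mul, map_zpow, map_zpow, hψN₁, hψN₂] at hker
  have hw1 : ψN w = 1 := by simp [ψN, hw]
  rw [hw1, mul_one] at hker
  have hker' := congrArg Multiplicative.toAdd hker
  simp only [toAdd_mul, toAdd_zpow, toAdd_ofAdd, toAdd_one, Prod.smul_mk, smul_zero,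
    Prod.mk_add_mk, add_zero, zero_add, Prod.mk_eq_zero, zsmul_eq_mul, mul_one] at hker'
  obtain ⟨hi, hj⟩ := hker'
  rw [ZMod.intCast_zmod_eq_zero_iff_dvd] at hi hj
  have hyi : y₁ ^ i ∈ K := hpowN y₁ i hi
  have hyj : y₂ ^ j ∈ K := hpowN y₂ j hj
  refine ⟨hyi, hyj, ?_⟩
  have hmemK : y₁ ^ i * y₂ ^ j * w ∈ K := hK'K hmem
  have hmemK' : y₁ ^ i * y₂ ^ j * w ∈ K.toSubgroup := hmemK
  have := K.toSubgroup.mul_mem (K.toSubgroup.inv_mem (K.toSubgroup.mul_mem hyi hyj)) hmemK'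
  simpa [mul_assoc, FiniteIndexNormalSubgroup.mem_toSubgroup_iff] using this

/-- **Independent cyclic subgroups have disjoint closures.**  If `ψ : F → ℤ²` sends `y₁ ↦ (1,0)`
and `y₂ ↦ (0,1)`, then `cl ι⟨y₁⟩ ∩ cl ι⟨y₂⟩ = 1` in the profinite completion of the residually
group `F` (residual finiteness is not needed for this half). [cite: MochizukiSemiAnbd2006, Lem. 6.1(i) p.69] -/
theorem eq_one_of_mem_closure_zpowers
    (h₁ : ψ y₁ = Multiplicative.ofAdd (1, 0)) (h₂ : ψ y₂ = Multiplicative.ofAdd (0, 1))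
    {c : completion (GrpCat.of F)}
    (hc₁ : c ∈ ((Subgroup.zpowers y₁).map (toProfiniteCompletion F)).topologicalClosure)
    (hc₂ : c ∈ ((Subgroup.zpowers y₂).map (toProfiniteCompletion F)).topologicalClosure) :
    c = 1 := by
  rw [mem_topologicalClosure_map_iff] at hc₁ hc₂
  apply completion_ext
  intro K
  obtain ⟨K', hK'K, hK'⟩ :=
    exists_finiteIndexNormalSubgroup_le_forall_zpow_mem ψ y₁ y₂ h₁ h₂ K
  obtain ⟨s₁, hs₁, hi⟩ := hc₁ K'
  obtain ⟨i, rfl⟩ := Subgroup.mem_zpowers_iff.1 hs₁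
  obtain ⟨s₂, hs₂, hj⟩ := hc₂ K'
  obtain ⟨j, rfl⟩ := Subgroup.mem_zpowers_iff.1 hs₂
  have hmem : y₁ ^ (-i) * y₂ ^ j * 1 ∈ K' := by
    have hij : ((y₁ ^ i : F) : F ⧸ K'.toSubgroup) = ((y₂ ^ j : F) : F ⧸ K'.toSubgroup) :=
      hi.trans hj.symm
    have := QuotientGroup.eq.1 hij
    simpa [zpow_neg, FiniteIndexNormalSubgroup.mem_toSubgroup_iff] using this
  obtain ⟨hy₁, -, -⟩ := hK' (-i) j 1 (map_one ψ) hmem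
  rw [completion_one_val, ← completion_rep_of_le c hK'K hi]
  change ((y₁ ^ i : F) : F ⧸ K.toSubgroup) = 1
  rw [QuotientGroup.eq_one_iff]
  simpa [zpow_neg, FiniteIndexNormalSubgroup.mem_toSubgroup_iff] using hy₁

/-- **Unique factorisation through independent cyclic closures.**  With `ψ, y₁, y₂` as above, if
`a ∈ cl ι⟨y₁⟩`, `b ∈ cl ι⟨y₂⟩` and `a * b ∈ ι(F)`, then `a ∈ ι⟨y₁⟩` (in particular `a ∈ ι(F)`).
[cite: MochizukiSemiAnbd2006, Lem. 6.1(i) p.69] -/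
theorem mem_image_zpowers_of_mul_mem_range [Group.ResiduallyFinite F]
    (h₁ : ψ y₁ = Multiplicative.ofAdd (1, 0)) (h₂ : ψ y₂ = Multiplicative.ofAdd (0, 1))
    {a b : completion (GrpCat.of F)}
    (ha : a ∈ ((Subgroup.zpowers y₁).map (toProfiniteCompletion F)).topologicalClosure)
    (hb : b ∈ ((Subgroup.zpowers y₂).map (toProfiniteCompletion F)).topologicalClosure)
    (hab : a * b ∈ (toProfiniteCompletion F).range) :
    a ∈ (Subgroup.zpowers y₁).map (toProfiniteCompletion F) := by
  set ι := toProfiniteCompletion F with hι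
  set A := ((Subgroup.zpowers y₁).map ι).topologicalClosure with hA
  set B := ((Subgroup.zpowers y₂).map ι).topologicalClosure with hB
  obtain ⟨w, hw⟩ := hab
  set k : ℤ := (Multiplicative.toAdd (ψ w)).1 with hk
  set m : ℤ := (Multiplicative.toAdd (ψ w)).2 with hm
  have hψw : ψ w = Multiplicative.ofAdd (k, m) := by
    rw [hk, hm]; rfl
  -- shifted elements
  set a' := ι (y₁ ^ (-k)) * a with ha'
  set b' := b * ι (y₂ ^ (-m)) with hb'
  set w' := y₁ ^ (-k) * w * y₂ ^ (-m) with hw'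
  have hyA : ∀ n : ℤ, ι (y₁ ^ n) ∈ A := fun n =>
    Subgroup.le_topologicalClosure _ (Subgroup.mem_map_of_mem _ (Subgroup.zpow_mem _
      (Subgroup.mem_zpowers y₁) n))
  have hyB : ∀ n : ℤ, ι (y₂ ^ n) ∈ B := fun n =>
    Subgroup.le_topologicalClosure _ (Subgroup.mem_map_of_mem _ (Subgroup.zpow_mem _
      (Subgroup.mem_zpowers y₂) n))
  have ha'A : a' ∈ A := A.mul_mem (hyA _) ha
  have hb'B : b' ∈ B := B.mul_mem hb (hyB _)
  have hψw' : ψ w' = 1 := by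
    rw [hw', map_mul, map_mul, map_zpow, map_zpow, h₁, h₂, hψw]
    apply Multiplicative.toAdd.injective
    simp only [toAdd_mul, toAdd_zpow, toAdd_ofAdd, toAdd_one]
    ext <;> simp
  have hιw' : ι w' = a' * b' := by
    rw [hw', map_mul, map_mul, hw, ha', hb']
    simp only [mul_assoc]
  -- `w' = 1` by residual finiteness and the refinement step
  have hw'1 : w' = 1 := by
    by_contra hne
    obtain ⟨K₀, hK₀⟩ := Group.exists_finiteIndexNormalSubgroup_notMem w' hne
    obtain ⟨K', hK'K, hK'⟩ :=
      exists_finiteIndexNormalSubgroup_le_forall_zpow_mem ψ y₁ y₂ h₁ h₂ K₀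
    obtain ⟨s₁, hs₁, hi⟩ := (mem_topologicalClosure_map_iff _ _).1 ha'A K'
    obtain ⟨i, rfl⟩ := Subgroup.mem_zpowers_iff.1 hs₁
    obtain ⟨s₂, hs₂, hj⟩ := (mem_topologicalClosure_map_iff _ _).1 hb'B K'
    obtain ⟨j, rfl⟩ := Subgroup.mem_zpowers_iff.1 hs₂
    have hval : (w' : F ⧸ K'.toSubgroup) = ((y₁ ^ i * y₂ ^ j : F) : F ⧸ K'.toSubgroup) := by
      have e1 : (w' : F ⧸ K'.toSubgroup) = (ι w').val K' := (toProfiniteCompletion_val w' K').symm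
      have e2 : (ι w').val K' = a'.val K' * b'.val K' := by rw [hιw']; rfl
      have e3 : ((y₁ ^ i * y₂ ^ j : F) : F ⧸ K'.toSubgroup) =
          ((y₁ ^ i : F) : F ⧸ K'.toSubgroup) * ((y₂ ^ j : F) : F ⧸ K'.toSubgroup) := rfl
      rw [e1, e2, e3, ← hi, ← hj]
      rfl
    have hmem : y₁ ^ i * y₂ ^ j * w'⁻¹ ∈ K' := by
      have h := QuotientGroup.eq.1 hval
      -- h : w'⁻¹ * (y₁ ^ i * y₂ ^ j) ∈ K'
      have := K'.isNormal'.mem_comm h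
      simpa [mul_assoc, FiniteIndexNormalSubgroup.mem_toSubgroup_iff] using this
    obtain ⟨-, -, hwK⟩ := hK' i j w'⁻¹ (by rw [map_inv, hψw', inv_one]) hmem
    exact hK₀ ((K₀.toSubgroup.inv_mem_iff).1 hwK)
  -- hence `a' = b'⁻¹ ∈ A ∩ B`, so `a' = 1`
  have hab' : a' * b' = 1 := by rw [← hιw', hw'1, map_one]
  have ha'B : a' ∈ B := by
    rw [eq_inv_of_mul_eq_one_left hab']
    exact B.inv_mem hb'B
  have ha'1 : a' = 1 := eq_one_of_mem_closure_zpowers ψ y₁ y₂ h₁ h₂ ha'A ha'B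
  have haeq : a = ι (y₁ ^ k) := by
    have : ι (y₁ ^ (-k)) * a = 1 := ha'1
    rw [zpow_neg, map_inv] at this
    exact (inv_mul_eq_one.1 this).symm
  rw [haeq]
  exact Subgroup.mem_map_of_mem _ (Subgroup.zpow_mem _ (Subgroup.mem_zpowers y₁) k)

end Separation

end Literature.AnabelianGeometry.SemiGraphs
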